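/-
Origin: expansion seat `planner-pub-hodgecm-pv13-0`, handover 2026-08-18T03:36:49Z (`HOME/pub-hodgecm-pv13/lean/Pv13/EulerProductPlaces.lean`, md5 d32b853d, 140 lines);
landed by the gen-5 packager in gate run 19 as `HodgeCM/PerL34/EulerProductPlaces.lean` (verbatim).
-/
/-
Origin: HOME/pub-hodgecm-pv13/lean/Pv13/EulerProductPlaces.lean — session planner-pub-hodgecm-pv13-0
(unit pub-hodgecm-pv13, DAG-NODE PROVER #13), node **N31h** of HOME/LEMMAS.md: the "ζ-comparison" input.
WIP module name `Pv13.EulerProductPlaces`; intended final place `HodgeCM/PerL34/EulerProductPlaces.lean`.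
Imports `Mathlib.*` only.  Nothing is asserted.
-/
import Mathlib.NumberTheory.NumberField.Basic
import Mathlib.RingTheory.DedekindDomain.AdicValuation
import Mathlib.RingTheory.Ideal.Int
import Mathlib.NumberTheory.RamificationInertia.Basic
import Mathlib.Analysis.PSeries
import Mathlib.Topology.Algebra.InfiniteSum.Real

set_option autoImplicit false

/-!
# N31h, the Dedekind-zeta comparison: `Σ_𝔭 N𝔭^r < ∞` for `r < −1` over the finite places of a number field

PerL v5 l. 631 ("`∏_v I_v(φ_v)` converges absolutely") uses, at the split unramified places, the comparison
`Σ_v q_v^{−3/2} < ∞`; the prior interface carried it as the NAMED INPUT `RallisDatum.A11_summable`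
("A-provable by comparison with `[L₀:ℚ]·Σ_p p^{−3/2}`").  PROVED here for the index type of finite places
`IsDedekindDomain.HeightOneSpectrum (𝓞 K)` of any number field `K` and any real exponent `r < −1`:

  `NumberField.summable_absNorm_rpow : Summable fun v => (absNorm v.asIdeal : ℝ) ^ r`.

Proof: the fibres of `v ↦ absNorm (v.asIdeal.under ℤ) = p` (the rational prime below `v`) have at most
`[K:ℚ]` elements (`Ideal.card_primesOverFinset_le_finrank`), `N v ≥ p` (`Int.absNorm_under_dvd_absNorm`), and
`Σ_{m∈ℕ} m^r < ∞` (`Real.summable_nat_rpow`); an abstract bounded-fibre comparison lemma does the rest.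
-/

namespace HodgeCM

namespace PerL34

namespace EulerProduct

/-- **Bounded-fibre comparison.** If `0 ≤ f ≤ g ∘ u`, every fibre of `u` meets every finite set in at most `n`
points, `g ≥ 0` and `Σ g < ∞`, then `Σ f < ∞`. -/
theorem summable_of_fibre_card_le {α β : Type*} [DecidableEq β] (u : α → β) {f : α → ℝ} {g : β → ℝ}
    (n : ℕ)
    (hf : ∀ a, 0 ≤ f a) (hg : ∀ b, 0 ≤ g b) (hle : ∀ a, f a ≤ g (u a))
    (hfib : ∀ (b : β) (T : Finset α), (T.filter fun a => u a = b).card ≤ n) (hgs : Summable g) :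
    Summable f := by
  classical
  refine summable_of_sum_le (c := n * ∑' b, g b) hf fun T => ?_
  calc ∑ a ∈ T, f a ≤ ∑ a ∈ T, g (u a) := Finset.sum_le_sum fun a _ => hle a
    _ = ∑ b ∈ T.image u, ∑ a ∈ T with u a = b, g b :=
        (Finset.sum_fiberwise_of_maps_to' (fun a ha => Finset.mem_image_of_mem u ha) g).symm
    _ = ∑ b ∈ T.image u, ((T.filter fun a => u a = b).card : ℝ) * g b := by
        refine Finset.sum_congr rfl fun b _ => ?_
        rw [Finset.sum_const, nsmul_eq_mul]
    _ ≤ ∑ b ∈ T.image u, (n : ℝ) * g b :=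
        Finset.sum_le_sum fun b _ => mul_le_mul_of_nonneg_right (by exact_mod_cast hfib b T) (hg b)
    _ = n * ∑ b ∈ T.image u, g b := (Finset.mul_sum _ _ _).symm
    _ ≤ n * ∑' b, g b :=
        mul_le_mul_of_nonneg_left (hgs.sum_le_tsum _ fun b _ => hg b) (Nat.cast_nonneg n)

end EulerProduct

end PerL34

end HodgeCM

namespace NumberField

open IsDedekindDomain Ideal

variable (K : Type*) [Field K] [NumberField K]

/-- The rational prime below a finite place `v` of `K`, as a natural number: `absNorm (v.asIdeal ∩ ℤ)`. -/
noncomputable def primeBelow (v : HeightOneSpectrum (𝓞 K)) : ℕ := absNorm (v.asIdeal.under ℤ)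

omit [NumberField K] in
/-- (Ported verbatim from the HodgeCMPerL package; no docstring in the source.) -/
theorem primeBelow_prime (v : HeightOneSpectrum (𝓞 K)) : (primeBelow K v).Prime := by
  haveI : v.asIdeal.IsPrime := v.isPrime
  haveI : NeZero v.asIdeal := ⟨v.ne_bot⟩
  exact Nat.absNorm_under_prime v.asIdeal

/-- (Ported verbatim from the HodgeCMPerL package; no docstring in the source.) -/
theorem primeBelow_dvd_absNorm (v : HeightOneSpectrum (𝓞 K)) : primeBelow K v ∣ absNorm v.asIdeal :=
  Int.absNorm_under_dvd_absNorm v.asIdeal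

/-- (Ported verbatim from the HodgeCMPerL package; no docstring in the source.) -/
theorem absNorm_ne_zero (v : HeightOneSpectrum (𝓞 K)) : absNorm v.asIdeal ≠ 0 :=
  fun h => v.ne_bot (absNorm_eq_zero_iff.mp h)

/-- (Ported verbatim from the HodgeCMPerL package; no docstring in the source.) -/
theorem primeBelow_le_absNorm (v : HeightOneSpectrum (𝓞 K)) : primeBelow K v ≤ absNorm v.asIdeal :=
  Nat.le_of_dvd (Nat.pos_of_ne_zero (absNorm_ne_zero K v)) (primeBelow_dvd_absNorm K v)

omit [NumberField K] in
/-- `v` lies over the rational prime below it. -/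
theorem liesOver_primeBelow (v : HeightOneSpectrum (𝓞 K)) :
    v.asIdeal.LiesOver (span {(primeBelow K v : ℤ)}) :=
  Int.liesOver_span_absNorm v.asIdeal

/-- **At most `[K:ℚ]` finite places lie over a given rational prime**: every finite set of places contains at
most `finrank ℚ K` places `v` with `primeBelow v = p`. -/
theorem card_filter_primeBelow_le (p : ℕ) (T : Finset (HeightOneSpectrum (𝓞 K))) :
    (T.filter fun v => primeBelow K v = p).card ≤ Module.finrank ℚ K := by
  classical
  by_cases hp : p.Prime
  · haveI : Fact p.Prime := ⟨hp⟩
    have hp0 : (span {(p : ℤ)} : Ideal ℤ) ≠ ⊥ := by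
      rw [Ne, span_singleton_eq_bot]
      exact_mod_cast hp.ne_zero
    refine le_trans ?_ (Ideal.card_primesOverFinset_le_finrank (R := ℤ) (𝓞 K) ℚ K hp0)
    refine Finset.card_le_card_of_injOn HeightOneSpectrum.asIdeal (fun v hv => ?_) ?_
    · have hv' : primeBelow K v = p := (Finset.mem_filter.mp hv).2
      rw [Finset.mem_coe, IsDedekindDomain.mem_primesOverFinset_iff hp0]
      refine ⟨v.isPrime, ?_⟩
      have := liesOver_primeBelow K v
      rwa [hv'] at this
    · intro v _ w _ h
      exact HeightOneSpectrum.ext h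
  · have : (T.filter fun v => primeBelow K v = p) = ∅ := by
      refine Finset.filter_eq_empty_iff.mpr fun v _ h => hp ?_
      rw [← h]
      exact primeBelow_prime K v
    rw [this, Finset.card_empty]
    exact Nat.zero_le _

/-- **Dedekind-zeta comparison** (PerL v5 l. 631; the prior interface's named input `A11_summable`):
for a number field `K` and a real `r < −1`, `Σ_v N(v)^r < ∞` over the finite places `v` of `K`. -/
theorem summable_absNorm_rpow {r : ℝ} (hr : r < -1) :
    Summable fun v : HeightOneSpectrum (𝓞 K) => (absNorm v.asIdeal : ℝ) ^ r := by
  refine HodgeCM.PerL34.EulerProduct.summable_of_fibre_card_le (primeBelow K)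
    (g := fun m : ℕ => (m : ℝ) ^ r) (Module.finrank ℚ K) (fun v => by positivity) (fun m => by positivity)
    (fun v => ?_) (card_filter_primeBelow_le K) (Real.summable_nat_rpow.mpr hr)
  have h1 : (0 : ℝ) < primeBelow K v := by exact_mod_cast (primeBelow_prime K v).pos
  have h2 : (primeBelow K v : ℝ) ≤ absNorm v.asIdeal := by exact_mod_cast primeBelow_le_absNorm K v
  exact Real.rpow_le_rpow_of_nonpos h1 h2 (by linarith)

/-- The instance used by N31h: `Σ_v q_v^{−3/2} < ∞` (`q_v = N(v)` the residue field size). -/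
theorem summable_absNorm_rpow_neg_three_halves :
    Summable fun v : HeightOneSpectrum (𝓞 K) => (absNorm v.asIdeal : ℝ) ^ (-(3 / 2 : ℝ)) :=
  summable_absNorm_rpow K (by norm_num)

/-- `q_v = N(v) ≥ 2`. -/
theorem two_le_absNorm (v : HeightOneSpectrum (𝓞 K)) : 2 ≤ absNorm v.asIdeal :=
  (primeBelow_prime K v).two_le.trans (primeBelow_le_absNorm K v)

end NumberField
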